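import Literature.Geometry.DiscreteGeometry.KissingSearchRoot
import Literature.Geometry.DiscreteGeometry.KissingSearchGeometry
import Literature.Geometry.DiscreteGeometry.KissingSearchRun000
import Literature.Geometry.DiscreteGeometry.KissingSearchRun001
import Literature.Geometry.DiscreteGeometry.KissingSearchRun002
import Literature.Geometry.DiscreteGeometry.KissingSearchRun003
import Literature.Geometry.DiscreteGeometry.KissingSearchRun004
import Literature.Geometry.DiscreteGeometry.KissingSearchRun005
import Literature.Geometry.DiscreteGeometry.KissingSearchRun006
import Literature.Geometry.DiscreteGeometry.KissingSearchRun007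
import Literature.Geometry.DiscreteGeometry.KissingSearchRun008
import Literature.Geometry.DiscreteGeometry.KissingSearchRun009
import Literature.Geometry.DiscreteGeometry.KissingSearchRun010
import Literature.Geometry.DiscreteGeometry.KissingSearchRun011
import Literature.Geometry.DiscreteGeometry.KissingSearchRun012
import Literature.Geometry.DiscreteGeometry.KissingSearchRun013
import Literature.Geometry.DiscreteGeometry.KissingSearchRun014
import Literature.Geometry.DiscreteGeometry.KissingSearchRun015
import Literature.Geometry.DiscreteGeometry.KissingSearchRun016
import Literature.Geometry.DiscreteGeometry.KissingSearchRun017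
import Literature.Geometry.DiscreteGeometry.KissingSearchRun018
import Literature.Geometry.DiscreteGeometry.KissingSearchRun019
import Literature.Geometry.DiscreteGeometry.KissingSearchRun020
import Literature.Geometry.DiscreteGeometry.KissingSearchRun021
import Literature.Geometry.DiscreteGeometry.KissingSearchRun022
import Literature.Geometry.DiscreteGeometry.KissingSearchRun023
import Literature.Geometry.DiscreteGeometry.KissingSearchRun024
import Literature.Geometry.DiscreteGeometry.KissingSearchRun025
import Literature.Geometry.DiscreteGeometry.KissingSearchRun026
import Literature.Geometry.DiscreteGeometry.KissingSearchRun027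
import Literature.Geometry.DiscreteGeometry.KissingSearchRun028
import Literature.Geometry.DiscreteGeometry.KissingSearchRun029
import Literature.Geometry.DiscreteGeometry.KissingSearchRun030
import Literature.Geometry.DiscreteGeometry.KissingSearchRun031
import Literature.Geometry.DiscreteGeometry.KissingSearchRun032
import Literature.Geometry.DiscreteGeometry.KissingSearchRun033
import Literature.Geometry.DiscreteGeometry.KissingSearchRun034
import Literature.Geometry.DiscreteGeometry.KissingSearchRun035
import Literature.Geometry.DiscreteGeometry.KissingSearchRun036
import Literature.Geometry.DiscreteGeometry.KissingSearchRun037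
import Literature.Geometry.DiscreteGeometry.KissingSearchRun038
import Literature.Geometry.DiscreteGeometry.KissingSearchRun039
import Literature.Geometry.DiscreteGeometry.KissingSearchRun040
import Literature.Geometry.DiscreteGeometry.KissingSearchRun041
import Literature.Geometry.DiscreteGeometry.KissingSearchRun042
import Literature.Geometry.DiscreteGeometry.KissingSearchRun043
import Literature.Geometry.DiscreteGeometry.KissingSearchRun044
import Literature.Geometry.DiscreteGeometry.KissingSearchRun045
import Literature.Geometry.DiscreteGeometry.KissingSearchRun046
import Literature.Geometry.DiscreteGeometry.KissingSearchRun047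
import Literature.Geometry.DiscreteGeometry.KissingSearchRun048
import Literature.Geometry.DiscreteGeometry.KissingSearchRun049
import Literature.Geometry.DiscreteGeometry.KissingSearchRun050
import Literature.Geometry.DiscreteGeometry.KissingSearchRun051
import Literature.Geometry.DiscreteGeometry.KissingSearchRun052
import Literature.Geometry.DiscreteGeometry.KissingSearchRun053
import Literature.Geometry.DiscreteGeometry.KissingSearchRun054
import Literature.Geometry.DiscreteGeometry.KissingSearchRun055
import Literature.Geometry.DiscreteGeometry.KissingSearchRun056
import Literature.Geometry.DiscreteGeometry.KissingSearchRun057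
import Literature.Geometry.DiscreteGeometry.KissingSearchRun058
import Literature.Geometry.DiscreteGeometry.KissingSearchRun059
import Literature.Geometry.DiscreteGeometry.KissingSearchRun060
import Literature.Geometry.DiscreteGeometry.KissingSearchRun061
import Literature.Geometry.DiscreteGeometry.KissingSearchRun062
import Literature.Geometry.DiscreteGeometry.KissingSearchRun063
import Literature.Geometry.DiscreteGeometry.KissingSearchRun064
import Literature.Geometry.DiscreteGeometry.KissingSearchRun065
import Literature.Geometry.DiscreteGeometry.KissingSearchRun066
import Literature.Geometry.DiscreteGeometry.KissingSearchRun067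
import Literature.Geometry.DiscreteGeometry.KissingSearchRun068
import Literature.Geometry.DiscreteGeometry.KissingSearchRun069
import Literature.Geometry.DiscreteGeometry.KissingSearchRun070
import Literature.Geometry.DiscreteGeometry.KissingSearchRun071
import Literature.Geometry.DiscreteGeometry.KissingSearchRun072
import Literature.Geometry.DiscreteGeometry.KissingSearchRun073
import Literature.Geometry.DiscreteGeometry.KissingSearchRun074
import Literature.Geometry.DiscreteGeometry.KissingSearchRun075
import Literature.Geometry.DiscreteGeometry.KissingSearchRun076
import Literature.Geometry.DiscreteGeometry.KissingSearchRun077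
import Literature.Geometry.DiscreteGeometry.KissingSearchRun078
import Literature.Geometry.DiscreteGeometry.KissingSearchRun079
import Literature.Geometry.DiscreteGeometry.KissingSearchRun080
import Literature.Geometry.DiscreteGeometry.KissingSearchRun081
import Literature.Geometry.DiscreteGeometry.KissingSearchRun082
import Literature.Geometry.DiscreteGeometry.KissingSearchRun083
import Literature.Geometry.DiscreteGeometry.KissingSearchRun084
import Literature.Geometry.DiscreteGeometry.KissingSearchRun085
import Literature.Geometry.DiscreteGeometry.KissingSearchRun086
import Literature.Geometry.DiscreteGeometry.KissingSearchRun087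
import Literature.Geometry.DiscreteGeometry.KissingSearchRun088
import Literature.Geometry.DiscreteGeometry.KissingSearchRun089
import Literature.Geometry.DiscreteGeometry.KissingSearchRun090
import Literature.Geometry.DiscreteGeometry.KissingSearchRun091
import Literature.Geometry.DiscreteGeometry.KissingSearchRun092
import Literature.Geometry.DiscreteGeometry.KissingSearchRun093
import Literature.Geometry.DiscreteGeometry.KissingSearchRun094
import Literature.Geometry.DiscreteGeometry.KissingSearchRun095
import Literature.Geometry.DiscreteGeometry.KissingSearchRun096
import Literature.Geometry.DiscreteGeometry.KissingSearchRun097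
import Literature.Geometry.DiscreteGeometry.KissingSearchRun098
import Literature.Geometry.DiscreteGeometry.KissingSearchRun099
import Literature.Geometry.DiscreteGeometry.KissingSearchRun100
import Literature.Geometry.DiscreteGeometry.KissingSearchRun101
import Literature.Geometry.DiscreteGeometry.KissingSearchRun102
import Literature.Geometry.DiscreteGeometry.KissingSearchRun103
import Literature.Geometry.DiscreteGeometry.KissingSearchRun104
import Literature.Geometry.DiscreteGeometry.KissingSearchRun105
import Literature.Geometry.DiscreteGeometry.KissingSearchRun106
import Literature.Geometry.DiscreteGeometry.KissingSearchRun107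
import Literature.Geometry.DiscreteGeometry.KissingSearchRun108
import Literature.Geometry.DiscreteGeometry.KissingSearchRun109
import Literature.Geometry.DiscreteGeometry.KissingSearchRun110
import Literature.Geometry.DiscreteGeometry.KissingSearchRun111
import Literature.Geometry.DiscreteGeometry.KissingSearchRun112
import Literature.Geometry.DiscreteGeometry.KissingSearchRun113
import Literature.Geometry.DiscreteGeometry.KissingSearchRun114
import Literature.Geometry.DiscreteGeometry.KissingSearchRun115
import Literature.Geometry.DiscreteGeometry.KissingSearchRun116
import Literature.Geometry.DiscreteGeometry.KissingSearchRun117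
import Literature.Geometry.DiscreteGeometry.KissingSearchRun118
import Literature.Geometry.DiscreteGeometry.KissingSearchRun119
import Literature.Geometry.DiscreteGeometry.KissingSearchRun120
import Literature.Geometry.DiscreteGeometry.KissingSearchRun121
import Literature.Geometry.DiscreteGeometry.KissingSearchRun122
import Literature.Geometry.DiscreteGeometry.KissingSearchRun123
import Literature.Geometry.DiscreteGeometry.KissingSearchRun124
import Literature.Geometry.DiscreteGeometry.KissingSearchRun125
import Literature.Geometry.DiscreteGeometry.KissingSearchRun126
import Literature.Geometry.DiscreteGeometry.KissingSearchRun127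
import HarnessLib

/-!
# Hales 2012, Theorem 3 with Lemmas 8–9 (graph form): the contact graph of a kissing
# configuration `V ∈ 𝒱` is the FCC or the HCP contact graph — PROVED (computationally)

Topic `Literature/Geometry/DiscreteGeometry`.  Assembly of the verified growth search:

* `checkPart_all` — the `128` parts of the run (`KissingSearchRun000 … 127.lean`, `native_decide`);
* `KConf.concl` — by `concl_of_parts` (`KissingSearchRoot.lean`): every abstract structure
  `M : KConf` (the local axioms of the fan-refined hull triangulation of a kissing configuration)
  has, up to a bijection of the labels, the FCC or the HCP contact graph;
* **`Hales2012_contactGraphFccOrHcp_holds`** — by the geometric dictionary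
  `contactGraphFccOrHcp_of_forall_concl` (`KissingSearchGeometry.lean`): the named fact
  `Hales2012_contactGraphFccOrHcp` (`FejesTothKissingTwelve.lean`) HOLDS;
* **`Hales2012_contactGraphTame_holds`** — hence the named fact `Hales2012_contactGraphTame`
  (`TameContactGraphs.lean`) holds as well (`i = 1` for FCC, `i = 0` for HCP);
* **`Hales2012_kissingConfigCongruent_holds`** — and, by Lemma 10 (proved in
  `KissingRigidity.lean`: `kissingConfigCongruent_of_contactGraphFccOrHcp`), the named fact
  `Hales2012_kissingConfigCongruent` (`FejesTothKissingTwelve.lean`): every kissing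
  configuration is congruent to the FCC or the HCP configuration.

The proofs depend on `Lean.ofReduceBool` (the run is by `native_decide`); everything else is
checked by the kernel.  This replaces Hales's chain "main estimate (Mathematica) + hypermap
generator PYWHMHQ + linear programs" by one verified interval-arithmetic search over labelled
fan triangulations (see the module docstrings of `KissingSearchCheck.lean` and
`KissingSearchDefs.lean` for the design).

## References
* T. C. Hales, *A proof of Fejes Tóth's conjecture on sphere packings with kissing number
  twelve*, arXiv:1209.6043 (2012), Theorem 3, Lemmas 8 and 9. [`Hales2012`]
-/

namespace Literature.Geometry.DiscreteGeometry

namespace KissingSearch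

/-- **All `128` parts of the run return `true`.** [cite: Hales2012, Theorem 3 and Lemma 8] -/
theorem checkPart_all : ∀ i, i < 128 → checkPart 5 128 i 60 = true := by
  intro i hi
  interval_cases i
  · exact checkPart_eq_true_000
  · exact checkPart_eq_true_001
  · exact checkPart_eq_true_002
  · exact checkPart_eq_true_003
  · exact checkPart_eq_true_004
  · exact checkPart_eq_true_005
  · exact checkPart_eq_true_006
  · exact checkPart_eq_true_007
  · exact checkPart_eq_true_008
  · exact checkPart_eq_true_009
  · exact checkPart_eq_true_010
  · exact checkPart_eq_true_011
  · exact checkPart_eq_true_012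
  · exact checkPart_eq_true_013
  · exact checkPart_eq_true_014
  · exact checkPart_eq_true_015
  · exact checkPart_eq_true_016
  · exact checkPart_eq_true_017
  · exact checkPart_eq_true_018
  · exact checkPart_eq_true_019
  · exact checkPart_eq_true_020
  · exact checkPart_eq_true_021
  · exact checkPart_eq_true_022
  · exact checkPart_eq_true_023
  · exact checkPart_eq_true_024
  · exact checkPart_eq_true_025
  · exact checkPart_eq_true_026
  · exact checkPart_eq_true_027
  · exact checkPart_eq_true_028
  · exact checkPart_eq_true_029
  · exact checkPart_eq_true_030
  · exact checkPart_eq_true_031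
  · exact checkPart_eq_true_032
  · exact checkPart_eq_true_033
  · exact checkPart_eq_true_034
  · exact checkPart_eq_true_035
  · exact checkPart_eq_true_036
  · exact checkPart_eq_true_037
  · exact checkPart_eq_true_038
  · exact checkPart_eq_true_039
  · exact checkPart_eq_true_040
  · exact checkPart_eq_true_041
  · exact checkPart_eq_true_042
  · exact checkPart_eq_true_043
  · exact checkPart_eq_true_044
  · exact checkPart_eq_true_045
  · exact checkPart_eq_true_046
  · exact checkPart_eq_true_047
  · exact checkPart_eq_true_048
  · exact checkPart_eq_true_049
  · exact checkPart_eq_true_050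
  · exact checkPart_eq_true_051
  · exact checkPart_eq_true_052
  · exact checkPart_eq_true_053
  · exact checkPart_eq_true_054
  · exact checkPart_eq_true_055
  · exact checkPart_eq_true_056
  · exact checkPart_eq_true_057
  · exact checkPart_eq_true_058
  · exact checkPart_eq_true_059
  · exact checkPart_eq_true_060
  · exact checkPart_eq_true_061
  · exact checkPart_eq_true_062
  · exact checkPart_eq_true_063
  · exact checkPart_eq_true_064
  · exact checkPart_eq_true_065
  · exact checkPart_eq_true_066
  · exact checkPart_eq_true_067
  · exact checkPart_eq_true_068
  · exact checkPart_eq_true_069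
  · exact checkPart_eq_true_070
  · exact checkPart_eq_true_071
  · exact checkPart_eq_true_072
  · exact checkPart_eq_true_073
  · exact checkPart_eq_true_074
  · exact checkPart_eq_true_075
  · exact checkPart_eq_true_076
  · exact checkPart_eq_true_077
  · exact checkPart_eq_true_078
  · exact checkPart_eq_true_079
  · exact checkPart_eq_true_080
  · exact checkPart_eq_true_081
  · exact checkPart_eq_true_082
  · exact checkPart_eq_true_083
  · exact checkPart_eq_true_084
  · exact checkPart_eq_true_085
  · exact checkPart_eq_true_086
  · exact checkPart_eq_true_087
  · exact checkPart_eq_true_088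
  · exact checkPart_eq_true_089
  · exact checkPart_eq_true_090
  · exact checkPart_eq_true_091
  · exact checkPart_eq_true_092
  · exact checkPart_eq_true_093
  · exact checkPart_eq_true_094
  · exact checkPart_eq_true_095
  · exact checkPart_eq_true_096
  · exact checkPart_eq_true_097
  · exact checkPart_eq_true_098
  · exact checkPart_eq_true_099
  · exact checkPart_eq_true_100
  · exact checkPart_eq_true_101
  · exact checkPart_eq_true_102
  · exact checkPart_eq_true_103
  · exact checkPart_eq_true_104
  · exact checkPart_eq_true_105
  · exact checkPart_eq_true_106
  · exact checkPart_eq_true_107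
  · exact checkPart_eq_true_108
  · exact checkPart_eq_true_109
  · exact checkPart_eq_true_110
  · exact checkPart_eq_true_111
  · exact checkPart_eq_true_112
  · exact checkPart_eq_true_113
  · exact checkPart_eq_true_114
  · exact checkPart_eq_true_115
  · exact checkPart_eq_true_116
  · exact checkPart_eq_true_117
  · exact checkPart_eq_true_118
  · exact checkPart_eq_true_119
  · exact checkPart_eq_true_120
  · exact checkPart_eq_true_121
  · exact checkPart_eq_true_122
  · exact checkPart_eq_true_123
  · exact checkPart_eq_true_124
  · exact checkPart_eq_true_125
  · exact checkPart_eq_true_126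
  · exact checkPart_eq_true_127

/-- **Every abstract structure has the FCC or the HCP contact graph.**
[cite: Hales2012, Theorem 3 and Lemma 9] -/
theorem KConf.concl (M : KConf) : M.Concl :=
  concl_of_parts (depth := 5) (parts := 128) (fuel := 60) (by norm_num) checkPart_all M

end KissingSearch

/-- **Hales 2012, Theorem 3 with Lemma 9 (graph form) HOLDS**: the contact graph of every kissing
configuration `V ∈ 𝒱` is isomorphic to that of the FCC or of the HCP configuration.
[cite: Hales2012, Theorem 3 and Lemma 9] -/
theorem Hales2012_contactGraphFccOrHcp_holds : Hales2012_contactGraphFccOrHcp :=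
  contactGraphFccOrHcp_of_forall_concl KissingSearch.KConf.concl

/-- **Hales 2012, Theorem 3 with Lemma 8 (graph form) HOLDS**: the contact graph of every kissing
configuration is one of the eight tame contact graphs (indeed number `1`, FCC, or `0`, HCP).
[cite: Hales2012, Theorem 3 and Lemma 8] -/
theorem Hales2012_contactGraphTame_holds : Hales2012_contactGraphTame := by
  intro S hS
  rcases Hales2012_contactGraphFccOrHcp_holds S hS with h | h
  · exact ⟨1, ⟨h.some.trans nonempty_tameContactGraph_one_iso_fcc.some.symm⟩⟩
  · exact ⟨0, ⟨h.some.trans nonempty_tameContactGraph_zero_iso_hcp.some.symm⟩⟩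

/-- **Hales 2012, Lemma 10 with Theorem 3 and Lemma 9 (congruence form) HOLDS**: every kissing
configuration `S ⊂ S²(2)` (twelve points at distance `2` from the origin, pairwise distances `2`
or `≥ 2h₀ = 2.52`) is the image of `2 · fccKissingPattern` or of `2 · hcpKissingPattern` under a
linear isometry of `ℝ³` — the named fact `Hales2012_kissingConfigCongruent` of
`FejesTothKissingTwelve.lean`, obtained from `Hales2012_contactGraphFccOrHcp_holds` (above) by
Lemma 10, which is proved in `KissingRigidity.lean`
(`kissingConfigCongruent_of_contactGraphFccOrHcp`: a configuration with the FCC/HCP contact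
graph is rigid up to isometry).  Like the theorem it rests
on, the proof depends on `Lean.ofReduceBool` (the verified search runs by `native_decide`).
[cite: Hales2012, Lemma 10 (with Theorem 3 and Lemma 9; proof of Theorem 1, p. 14)] -/
theorem Hales2012_kissingConfigCongruent_holds : Hales2012_kissingConfigCongruent :=
  kissingConfigCongruent_of_contactGraphFccOrHcp Hales2012_contactGraphFccOrHcp_holds

end Literature.Geometry.DiscreteGeometry
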